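import Mathlib.Algebra.BigOperators.Ring.Finset
import Mathlib.Algebra.BigOperators.Field
import Mathlib.Algebra.Order.BigOperators.Group.Finset
import Mathlib.Data.Fintype.BigOperators
import Mathlib.Data.Real.Basic
import Mathlib.Data.Nat.Choose.Sum
import Mathlib.Data.Nat.Choose.Basic
import Mathlib.Logic.Equiv.Defs
import HarnessLib

/-!
# Averaging tools for Rothvoß's measure comparison (generic finite double counting)

Support file for the discharge of `Literature.Barriers.PneNP.Rothvoss2017_tsp` (Rothvoß 2017,
§3). Three generic finite-averaging facts, isolated from the combinatorics so that the later
files only instantiate them: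

* `card_filter_and_le_of_fibres` — **the re-randomisation trick** used for Lemmas 14 and 15
  (PDF pp. 11–12: "we imagine that we generate the random partition … in two phases … in the
  second phase we take a random uniform index `i`"): if a family of bijections `φ_i` of a finite
  probability space is such that, POINTWISE at every sample `ω`, among the indices `i` with
  `P(φ_i ω)` at most an `ε`-fraction also satisfy `Q(φ_i ω)`, then among all samples with `P` at
  most an `ε`-fraction satisfy `Q` (sum over `i`, use that each `φ_i` is measure preserving,
  exchange the sums).
* `sum_mul_card_inter_eq` — **the exchange of expectations** of §3.6 (PDF p. 11, "(U,M) first,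
  then `T ∼ 𝒫(U,M)`"): `Σ_ω f(ω) · |A(ω) ∩ 𝒰| · |B(ω) ∩ ℳ|` equals
  `Σ_{U ∈ 𝒰} Σ_{M ∈ ℳ} Σ_{ω : U ∈ A(ω), M ∈ B(ω)} f(ω)`.
* `two_pow_le_succ_mul_choose_middle` — `2^{2μ+1} ≤ (2μ+2) · C(2μ+1, μ+1)` (the central
  binomial coefficient is at least average), used for "`|Y| ≥ 2^{-δm} C(m, (m+1)/2) ≥ 2^{-2δm}|X|`"
  (PDF p. 12).

All [folklore].
-/

namespace Literature.Barriers.PneNP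

open Finset

/-! ### Measure-preserving re-indexing -/

/-- Filtering a predicate composed with a bijection does not change the count. [folklore] -/
theorem card_filter_comp_equiv {Ω : Type*} [Fintype Ω] (e : Ω ≃ Ω) (R : Ω → Prop)
    [DecidablePred R] :
    (univ.filter fun ω => R (e ω)).card = (univ.filter R).card := by
  refine card_bij (fun ω _ => e ω) (fun ω hω => ?_) (fun ω₁ _ ω₂ _ h => e.injective h)
    (fun ω hω => ⟨e.symm ω, ?_, by simp⟩)
  · rw [mem_filter] at hω ⊢
    exact ⟨mem_univ _, hω.2⟩
  · rw [mem_filter] at hω ⊢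
    exact ⟨mem_univ _, by simpa using hω.2⟩

/-- **Re-randomisation trick.** Let `φ_i` (`i ∈ I`, nonempty finite) be bijections of a finite
set `Ω` and `P, Q` predicates. If for every `ω` the number of `i` with `P (φ_i ω) ∧ Q (φ_i ω)` is
at most `ε` times the number of `i` with `P (φ_i ω)`, then `|{P ∧ Q}| ≤ ε |{P}|`.
[cite: Rothvoss2017, proofs of Lemmas 14–15 (PDF pp. 11–12)] -/
theorem card_filter_and_le_of_fibres {Ω I : Type*} [Fintype Ω] [Fintype I] [Nonempty I]
    (φ : I → Ω ≃ Ω) (P Q : Ω → Prop) [DecidablePred P] [DecidablePred Q] (ε : ℝ)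
    (h : ∀ ω, ((univ.filter fun i => P (φ i ω) ∧ Q (φ i ω)).card : ℝ) ≤
      ε * ((univ.filter fun i => P (φ i ω)).card : ℝ)) :
    ((univ.filter fun ω => P ω ∧ Q ω).card : ℝ) ≤ ε * ((univ.filter fun ω => P ω).card : ℝ) := by
  classical
  have hI : (0 : ℝ) < Fintype.card I := by exact_mod_cast Fintype.card_pos
  -- both sides summed over `i`, with `ω` replaced by `φ_i ω`
  have hPQ : ∀ i, ((univ.filter fun ω => P (φ i ω) ∧ Q (φ i ω)).card : ℝ) =
      ((univ.filter fun ω => P ω ∧ Q ω).card : ℝ) := fun i => by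
    exact_mod_cast card_filter_comp_equiv (φ i) (fun ω => P ω ∧ Q ω)
  have hP : ∀ i, ((univ.filter fun ω => P (φ i ω)).card : ℝ) =
      ((univ.filter fun ω => P ω).card : ℝ) := fun i => by
    exact_mod_cast card_filter_comp_equiv (φ i) P
  -- double counting of the pairs `(i, ω)`
  have hswapPQ : ∑ i : I, ((univ.filter fun ω => P (φ i ω) ∧ Q (φ i ω)).card : ℝ) =
      ∑ ω : Ω, ((univ.filter fun i => P (φ i ω) ∧ Q (φ i ω)).card : ℝ) := by
    simp only [card_filter, Nat.cast_sum]
    rw [sum_comm]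
  have hswapP : ∑ i : I, ((univ.filter fun ω => P (φ i ω)).card : ℝ) =
      ∑ ω : Ω, ((univ.filter fun i => P (φ i ω)).card : ℝ) := by
    simp only [card_filter, Nat.cast_sum]
    rw [sum_comm]
  have key : (Fintype.card I : ℝ) * ((univ.filter fun ω => P ω ∧ Q ω).card : ℝ) ≤
      ε * ((Fintype.card I : ℝ) * ((univ.filter fun ω => P ω).card : ℝ)) := by
    calc (Fintype.card I : ℝ) * ((univ.filter fun ω => P ω ∧ Q ω).card : ℝ)
        = ∑ i : I, ((univ.filter fun ω => P (φ i ω) ∧ Q (φ i ω)).card : ℝ) := by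
          simp only [hPQ, sum_const, card_univ, nsmul_eq_mul]
      _ = ∑ ω : Ω, ((univ.filter fun i => P (φ i ω) ∧ Q (φ i ω)).card : ℝ) := hswapPQ
      _ ≤ ∑ ω : Ω, ε * ((univ.filter fun i => P (φ i ω)).card : ℝ) := sum_le_sum fun ω _ => h ω
      _ = ε * ∑ ω : Ω, ((univ.filter fun i => P (φ i ω)).card : ℝ) := by rw [mul_sum]
      _ = ε * ∑ i : I, ((univ.filter fun ω => P (φ i ω)).card : ℝ) := by rw [hswapP]
      _ = ε * ((Fintype.card I : ℝ) * ((univ.filter fun ω => P ω).card : ℝ)) := by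
          simp only [hP, sum_const, card_univ, nsmul_eq_mul]
  have key' : (Fintype.card I : ℝ) * ((univ.filter fun ω => P ω ∧ Q ω).card : ℝ) ≤
      (Fintype.card I : ℝ) * (ε * ((univ.filter fun ω => P ω).card : ℝ)) := by linarith
  exact le_of_mul_le_mul_left key' hI

/-! ### Exchange of summation -/

/-- The size of `A ∩ 𝒰` as an indicator sum over `𝒰`. [folklore] -/
theorem card_inter_eq_sum_ite {α : Type*} [DecidableEq α] (A 𝒰 : Finset α) :
    ((A ∩ 𝒰).card : ℝ) = ∑ U ∈ 𝒰, if U ∈ A then 1 else 0 := by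
  rw [← sum_filter, sum_const, nsmul_eq_mul, mul_one]
  congr 1
  rw [filter_mem_eq_inter, inter_comm]

/-- **Exchange of expectations** (finite form): summing `f(ω) |A(ω) ∩ 𝒰| |B(ω) ∩ ℳ|` over
`ω` is summing `f` over the samples compatible with each pair `(U, M) ∈ 𝒰 × ℳ`.
[cite: Rothvoss2017, §3.6 (PDF p. 11)] -/
theorem sum_mul_card_inter_eq {Ω α β : Type*} [Fintype Ω] [DecidableEq α] [DecidableEq β]
    (f : Ω → ℝ) (A : Ω → Finset α) (B : Ω → Finset β) (𝒰 : Finset α) (ℳ : Finset β)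
    [∀ U M, DecidablePred fun ω => U ∈ A ω ∧ M ∈ B ω] :
    ∑ ω, f ω * ((A ω ∩ 𝒰).card : ℝ) * ((B ω ∩ ℳ).card : ℝ) =
      ∑ U ∈ 𝒰, ∑ M ∈ ℳ, ∑ ω ∈ univ.filter (fun ω => U ∈ A ω ∧ M ∈ B ω), f ω := by
  calc ∑ ω, f ω * ((A ω ∩ 𝒰).card : ℝ) * ((B ω ∩ ℳ).card : ℝ)
      = ∑ ω, ∑ U ∈ 𝒰, ∑ M ∈ ℳ,
          f ω * ((if U ∈ A ω then 1 else 0) * (if M ∈ B ω then 1 else 0)) := by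
        refine sum_congr rfl fun ω _ => ?_
        rw [card_inter_eq_sum_ite, card_inter_eq_sum_ite, mul_assoc, sum_mul_sum, mul_sum]
        refine sum_congr rfl fun U _ => ?_
        rw [mul_sum]
    _ = ∑ U ∈ 𝒰, ∑ ω, ∑ M ∈ ℳ,
          f ω * ((if U ∈ A ω then 1 else 0) * (if M ∈ B ω then 1 else 0)) := sum_comm
    _ = ∑ U ∈ 𝒰, ∑ M ∈ ℳ, ∑ ω,
          f ω * ((if U ∈ A ω then 1 else 0) * (if M ∈ B ω then 1 else 0)) := by
        refine sum_congr rfl fun U _ => ?_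
        exact sum_comm
    _ = ∑ U ∈ 𝒰, ∑ M ∈ ℳ, ∑ ω ∈ univ.filter (fun ω => U ∈ A ω ∧ M ∈ B ω), f ω := by
        refine sum_congr rfl fun U _ => sum_congr rfl fun M _ => ?_
        rw [sum_filter]
        refine sum_congr rfl fun ω _ => ?_
        by_cases hU : U ∈ A ω <;> by_cases hM : M ∈ B ω <;> simp [hU, hM]

/-! ### The central binomial coefficient is at least average -/

/-- `2^{2μ+1} ≤ (2μ+2) · C(2μ+1, μ+1)`. [folklore] -/
theorem two_pow_le_succ_mul_choose_middle (μ : ℕ) :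
    2 ^ (2 * μ + 1) ≤ (2 * μ + 2) * Nat.choose (2 * μ + 1) (μ + 1) := by
  have hsymm : Nat.choose (2 * μ + 1) (μ + 1) = Nat.choose (2 * μ + 1) μ := by
    rw [Nat.choose_symm_half]
  rw [hsymm, ← Nat.sum_range_choose]
  have hmid : ∀ j ∈ range (2 * μ + 1 + 1), Nat.choose (2 * μ + 1) j ≤ Nat.choose (2 * μ + 1) μ := by
    intro j _
    have := Nat.choose_le_middle j (2 * μ + 1)
    rwa [show (2 * μ + 1) / 2 = μ by omega] at this
  calc ∑ j ∈ range (2 * μ + 1 + 1), Nat.choose (2 * μ + 1) j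
      ≤ ∑ _j ∈ range (2 * μ + 1 + 1), Nat.choose (2 * μ + 1) μ := sum_le_sum hmid
    _ = (2 * μ + 2) * Nat.choose (2 * μ + 1) μ := by
        rw [sum_const, card_range, smul_eq_mul]

end Literature.Barriers.PneNP
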